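import Summits.FinalStateConjecture.FinalStateConjecture.Theorems.PhaseMixingCaptureCaptureSufficesTameNoC0LimitLemmas
import HarnessLib

/-!
# NoC0KerrChart limit argument III: the lowest point of `C_n` on a vertical segment

Crux `CaptureSufficesTame` (stmt-FinalStateConjecture-17270), line `only-the-third-law-is-generic`, NoC0KerrChart
programme, lead c10. Registered sub-goal of this file: `stub_noC0_lowestPoint` (`NoC0.lowest_point`): for `ε_n < 1/200`
the vertical segment `{Γ s + u ∂_{t*} : u ∈ [−2s, s]}` through a small orbit point meets `C_n` in a closed set containing
the top point (incidence curve (INC) + (hD)); its lowest point is in `C_n ∖ O_n` and has `u ≥ −s` (`C_n ⊆ {t* ≥ 0}`).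
Pure coordinate analysis (no manifold structure). [folklore]
-/

set_option linter.dupNamespace false
set_option maxSynthPendingDepth 3

noncomputable section

open Set Filter Function Bundle MeasureTheory Metric
open scoped Manifold ContDiff Topology ENNReal

namespace Summit.FinalStateConjecture.FinalStateConjecture.Theorems.PhaseMixingCaptureCaptureSufficesTame

open Literature.Geometry.Lorentzian Literature.Geometry.Riemannian

namespace NoC0

variable {M a : ℝ}

/-- **The lowest point of `C_n` on the vertical segment through a small orbit point.** For `ε_n < 1/200` the top point
`Γ s + s ∂_{t*}` is in `O_n` — the end of the `B_n`-timelike incidence curve `w ↦ Γ w + w ∂_{t*}` from `p₀ ∈ C_n` (INC) — so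
`{u ∈ [−2s, s] : Γ s + u ∂_{t*} ∈ C_n}` is closed and non-empty; its infimum `u` gives a point of `C_n ∖ O_n` (minimality and
openness of `O_n`), and `u ≥ −s` because `C_n` lies in `{t* ≥ 0}`. [folklore] -/
theorem lowest_point (M a r₀ e S : ℝ) (hM : 0 < M) (ha0 : 0 ≤ a) (haM : a ≤ M) (h3 : 3 * M ≤ r₀)
    (hcubic : r₀ * (r₀ - 3 * M) ^ 2 = 4 * a ^ 2 * M) (he : e = 1 - a * √(M / r₀ ^ 3)) (he0 : 0 < e) (hS0 : 0 ≤ S)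
    (Ω : Set E4) (η₀ : ℝ) (htube : cthickening η₀ (Kerr.orbitCurve a r₀ √(M / r₀ ^ 3) '' Icc (-S) (2 * S)) ⊆ Ω)
    (hINC : ∀ (M a r₀ q e κ w : ℝ), 0 < M → 0 ≤ a → a ≤ M → 3 * M ≤ r₀ → r₀ * (r₀ - 3 * M) ^ 2 = 4 * a ^ 2 * M →
      q = √(M / r₀ ^ 3) → e = 1 - a * q → 0 < κ →
      0 < e ∧ e ≤ 1 ∧ 0 < q ∧
      HasDerivAt (fun w ↦ Kerr.orbitCurve a r₀ q (w / e) + (κ * w) • E4.basisVector 0)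
        ((1 / e) • Kerr.orbitVel a q (Kerr.orbitCurve a r₀ q (w / e)) + κ • E4.basisVector 0) w ∧
      Kerr.bilin M a (Kerr.orbitCurve a r₀ q (w / e) + (κ * w) • E4.basisVector 0)
        ((1 / e) • Kerr.orbitVel a q (Kerr.orbitCurve a r₀ q (w / e)) + κ • E4.basisVector 0)
        ((1 / e) • Kerr.orbitVel a q (Kerr.orbitCurve a r₀ q (w / e)) + κ • E4.basisVector 0) ≤ -(κ / 10) ∧
      ((1 / e) • Kerr.orbitVel a q (Kerr.orbitCurve a r₀ q (w / e)) + κ • E4.basisVector 0) 0 = 1 + κ ∧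
      ‖(1 / e) • Kerr.orbitVel a q (Kerr.orbitCurve a r₀ q (w / e)) + κ • E4.basisVector 0‖ ≤ 3 + κ)
    (ε : ℕ → ℝ) (hε0 : ∀ n, 0 ≤ ε n)
    (B : ℕ → E4 → E4 →L[ℝ] E4 →L[ℝ] ℝ) (hB : ∀ n, ∀ y ∈ Ω, ‖B n y - Kerr.bilin M a y‖ ≤ ε n)
    (C O : ℕ → Set E4) (hOC : ∀ n, O n ⊆ C n) (hOo : ∀ n, IsOpen (O n))
    (hCcl : ∀ n, ∀ y ∈ Ω, y ∈ closure (C n) → y ∈ C n)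
    (hD : ∀ n, ∀ y ∈ C n, ∀ z ∈ Ω, (∃ (c : ℝ → E4) (s₁ s₂ : ℝ), s₁ < s₂ ∧ c s₁ = y ∧ c s₂ = z ∧
      ∀ t ∈ Icc s₁ s₂, c t ∈ Ω ∧ ∃ v : E4, HasDerivAt c v t ∧ B n (c t) v v < 0 ∧ 0 < v 0) → z ∈ O n)
    (hp : ∀ n, Kerr.orbitCurve a r₀ √(M / r₀ ^ 3) 0 ∈ C n ∧ Kerr.orbitCurve a r₀ √(M / r₀ ^ 3) 0 ∉ O n)
    (ht : ∀ n, ∀ y ∈ C n, Kerr.orbitCurve a r₀ √(M / r₀ ^ 3) 0 0 ≤ y 0)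
    (s : ℝ) (hs : 0 < s) (hsη : 10 * s ≤ η₀) (hsS : 2 * s ≤ e * S) (n : ℕ) (hn : ε n < 1 / 200) :
    ∃ u ∈ Icc (-s) s, Kerr.orbitCurve a r₀ √(M / r₀ ^ 3) (s / e) + u • E4.basisVector 0 ∈ C n ∧
      Kerr.orbitCurve a r₀ √(M / r₀ ^ 3) (s / e) + u • E4.basisVector 0 ∉ O n := by
  have htime : ∀ s, Kerr.orbitCurve a r₀ √(M / r₀ ^ 3) s 0 = e * s := fun s ↦ by
    rw [Kerr.orbitCurve_apply_zero, he]
  have he0x : ∀ t, Kerr.orbitCurve a r₀ √(M / r₀ ^ 3) (t / e) 0 = t := fun t ↦ by rw [htime]; field_simp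
  have hp00 : Kerr.orbitCurve a r₀ √(M / r₀ ^ 3) 0 0 = 0 := by rw [htime, mul_zero]
  have hΩnear : ∀ t z, 0 ≤ t → t ≤ 2 * (e * S) → ‖z - Kerr.orbitCurve a r₀ √(M / r₀ ^ 3) (t / e)‖ ≤ η₀ → z ∈ Ω :=
    fun t z ht0 htS hz ↦ htube (mem_orbitTube he0 hS0 t z ht0 htS hz)
  -- the orbit point and the vertical segment through it
  set x₀ : E4 := Kerr.orbitCurve a r₀ √(M / r₀ ^ 3) (s / e) with hx₀
  have hx₀0 : x₀ 0 = s := he0x s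
  have hsmall : s ≤ 2 * (e * S) := by linarith
  have hne0 : ‖E4.basisVector 0‖ = 1 := by simp [E4.basisVector]
  have hvertΩ : ∀ u : ℝ, |u| ≤ 2 * s → x₀ + u • E4.basisVector 0 ∈ Ω := fun u hu ↦
    hΩnear s _ hs.le hsmall (by rw [add_sub_cancel_left, norm_smul, hne0, mul_one, Real.norm_eq_abs]; linarith)
  /- ── Step 3: the top point is in `O n` ── -/
  have htop : ∀ n, ε n < 1 / 200 → x₀ + s • E4.basisVector 0 ∈ O n := by
    intro n hn
    refine hD n _ (hp n).1 _ (hvertΩ s (by rw [abs_of_pos hs]; linarith))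
      ⟨fun w ↦ Kerr.orbitCurve a r₀ √(M / r₀ ^ 3) (w / e) + (1 * w) • E4.basisVector 0, 0, s, hs,
        by simp, by simp [hx₀], fun w hw ↦ ?_⟩
    obtain ⟨-, -, -, hd, hbil, hV0, hVn⟩ := hINC M a r₀ (√(M / r₀ ^ 3)) e 1 w hM ha0 haM h3 hcubic rfl he one_pos
    have hwΩ : Kerr.orbitCurve a r₀ √(M / r₀ ^ 3) (w / e) + (1 * w) • E4.basisVector 0 ∈ Ω :=
      hΩnear w _ hw.1 (hw.2.trans hsmall)
        (by rw [add_sub_cancel_left, norm_smul, hne0, mul_one, one_mul, Real.norm_eq_abs, abs_of_nonneg hw.1]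
            linarith [hw.2])
    refine ⟨hwΩ, _, hd, ?_, by rw [hV0]; norm_num⟩
    have h1 := (B n (Kerr.orbitCurve a r₀ √(M / r₀ ^ 3) (w / e) + (1 * w) • E4.basisVector 0) -
      Kerr.bilin M a (Kerr.orbitCurve a r₀ √(M / r₀ ^ 3) (w / e) + (1 * w) • E4.basisVector 0)).le_opNorm₂
      ((1 / e) • Kerr.orbitVel a √(M / r₀ ^ 3) (Kerr.orbitCurve a r₀ √(M / r₀ ^ 3) (w / e)) + (1 : ℝ) • E4.basisVector 0)
      ((1 / e) • Kerr.orbitVel a √(M / r₀ ^ 3) (Kerr.orbitCurve a r₀ √(M / r₀ ^ 3) (w / e)) + (1 : ℝ) • E4.basisVector 0)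
    rw [Real.norm_eq_abs, sub_apply, sub_apply] at h1
    have hclose := hB n _ hwΩ
    have h2 : ‖B n (Kerr.orbitCurve a r₀ √(M / r₀ ^ 3) (w / e) + (1 * w) • E4.basisVector 0) -
        Kerr.bilin M a (Kerr.orbitCurve a r₀ √(M / r₀ ^ 3) (w / e) + (1 * w) • E4.basisVector 0)‖ *
        ‖(1 / e) • Kerr.orbitVel a √(M / r₀ ^ 3) (Kerr.orbitCurve a r₀ √(M / r₀ ^ 3) (w / e)) + (1 : ℝ) • E4.basisVector 0‖ *
        ‖(1 / e) • Kerr.orbitVel a √(M / r₀ ^ 3) (Kerr.orbitCurve a r₀ √(M / r₀ ^ 3) (w / e)) + (1 : ℝ) • E4.basisVector 0‖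
        ≤ ε n * 4 * 4 := by
      have h4 : ‖(1 / e) • Kerr.orbitVel a √(M / r₀ ^ 3) (Kerr.orbitCurve a r₀ √(M / r₀ ^ 3) (w / e)) +
        (1 : ℝ) • E4.basisVector 0‖ ≤ 4 := by linarith
      have hε := hε0 n
      exact mul_le_mul (mul_le_mul hclose h4 (norm_nonneg _) hε) h4 (norm_nonneg _) (by positivity)
    have h3' := (abs_le.1 (h1.trans h2)).2
    linarith
  /- ── Step 4: the lowest point of `C n` on the vertical segment ── -/
  have hcross : ∀ n, ε n < 1 / 200 → ∃ u ∈ Icc (-s) s, x₀ + u • E4.basisVector 0 ∈ C n ∧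
      x₀ + u • E4.basisVector 0 ∉ O n := by
    intro n hn
    set A : Set ℝ := {u | u ∈ Icc (-2 * s) s ∧ x₀ + u • E4.basisVector 0 ∈ C n} with hA
    have hsA : s ∈ A := ⟨⟨by linarith, le_rfl⟩, hOC n (htop n hn)⟩
    have hbdd : BddBelow A := ⟨-2 * s, fun u hu ↦ hu.1.1⟩
    have hAcl : IsClosed A := by
      refine isClosed_of_closure_subset fun u hu ↦ ?_
      have hI : u ∈ Icc (-2 * s) s := closure_minimal (fun v (hv : v ∈ A) ↦ hv.1) isClosed_Icc hu
      refine ⟨hI, hCcl n _ (hvertΩ u (abs_le.2 ⟨by linarith [hI.1], by linarith [hI.2]⟩)) ?_⟩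
      have hcont : Continuous fun v : ℝ ↦ x₀ + v • E4.basisVector 0 := by fun_prop
      have h1 := hcont.continuousWithinAt.mem_closure_image hu
      exact closure_mono (by rintro _ ⟨v, hv, rfl⟩; exact hv.2) h1
    have huA : sInf A ∈ A := hAcl.csInf_mem ⟨s, hsA⟩ hbdd
    have hlow : -s ≤ sInf A := by
      have h1 := ht n _ huA.2
      have h2 : (x₀ + sInf A • E4.basisVector 0) 0 = s + sInf A := by simp [hx₀0]
      rw [hp00, h2] at h1
      linarith
    refine ⟨sInf A, ⟨hlow, huA.1.2⟩, huA.2, fun hO ↦ ?_⟩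
    obtain ⟨δ, hδ, hball⟩ := Metric.isOpen_iff.1 (hOo n) _ hO
    have hm : 0 < min (δ / 2) (s / 2) := lt_min (half_pos hδ) (half_pos hs)
    have hu'A : sInf A - min (δ / 2) (s / 2) ∈ A := by
      refine ⟨⟨?_, ?_⟩, hOC n (hball ?_)⟩
      · have := min_le_right (δ / 2) (s / 2); linarith
      · linarith [huA.1.2]
      · rw [Metric.mem_ball, dist_eq_norm]
        have hcalc : x₀ + (sInf A - min (δ / 2) (s / 2)) • E4.basisVector 0 - (x₀ + sInf A • E4.basisVector 0) =
            (-(min (δ / 2) (s / 2))) • E4.basisVector 0 := by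
          rw [sub_smul, neg_smul]; abel
        rw [hcalc, norm_smul, norm_neg, hne0, mul_one, Real.norm_eq_abs, abs_of_pos hm]
        linarith [min_le_left (δ / 2) (s / 2)]
    have := csInf_le hbdd hu'A
    linarith
  exact hcross n hn

end NoC0

/-- **Registered sub-goal `stub_noC0_lowestPoint`** (NoC0KerrChart programme, crux `CaptureSufficesTame`, line
`only-the-third-law-is-generic`): the lowest point of `C_n` on the vertical segment (`NoC0.lowest_point`), verbatim. [folklore] -/
theorem stub_noC0_lowestPoint :
    ∀ (M a r₀ e S : ℝ), (0 < M) → (0 ≤ a) → (a ≤ M) → (3 * M ≤ r₀) → (r₀ * (r₀ - 3 * M) ^ 2 = 4 * a ^ 2 * M) → (e = 1 - a * √(M / r₀ ^ 3)) → (0 < e) → (0 ≤ S) → ∀ (Ω : Set E4), ∀ (η₀ : ℝ),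
      (cthickening η₀ (Kerr.orbitCurve a r₀ √(M / r₀ ^ 3) '' Icc (-S) (2 * S)) ⊆ Ω) → (∀ (M a r₀ q e κ w : ℝ), 0 < M → 0 ≤ a → a ≤ M → 3 * M ≤ r₀ → r₀ * (r₀ - 3 * M) ^ 2 = 4 * a ^ 2 * M → q
      = √(M / r₀ ^ 3) → e = 1 - a * q → 0 < κ → 0 < e ∧ e ≤ 1 ∧ 0 < q ∧ HasDerivAt (fun w ↦ Kerr.orbitCurve a r₀ q (w / e) + (κ * w) • E4.basisVector 0) ((1 / e) • Kerr.orbitVel a q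
      (Kerr.orbitCurve a r₀ q (w / e)) + κ • E4.basisVector 0) w ∧ Kerr.bilin M a (Kerr.orbitCurve a r₀ q (w / e) + (κ * w) • E4.basisVector 0) ((1 / e) • Kerr.orbitVel a q (Kerr.orbitCurve
      a r₀ q (w / e)) + κ • E4.basisVector 0) ((1 / e) • Kerr.orbitVel a q (Kerr.orbitCurve a r₀ q (w / e)) + κ • E4.basisVector 0) ≤ -(κ / 10) ∧ ((1 / e) • Kerr.orbitVel a q
      (Kerr.orbitCurve a r₀ q (w / e)) + κ • E4.basisVector 0) 0 = 1 + κ ∧ ‖(1 / e) • Kerr.orbitVel a q (Kerr.orbitCurve a r₀ q (w / e)) + κ • E4.basisVector 0‖ ≤ 3 + κ) → ∀ (ε : ℕ → ℝ), (∀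
      n, 0 ≤ ε n) → ∀ (B : ℕ → E4 → E4 →L[ℝ] E4 →L[ℝ] ℝ), (∀ n, ∀ y ∈ Ω, ‖B n y - Kerr.bilin M a y‖ ≤ ε n) → ∀ (C O : ℕ → Set E4), (∀ n, O n ⊆ C n) → (∀ n, IsOpen (O n)) → (∀ n, ∀ y ∈ Ω, y ∈
      closure (C n) → y ∈ C n) → (∀ n, ∀ y ∈ C n, ∀ z ∈ Ω, (∃ (c : ℝ → E4) (s₁ s₂ : ℝ), s₁ < s₂ ∧ c s₁ = y ∧ c s₂ = z ∧ ∀ t ∈ Icc s₁ s₂, c t ∈ Ω ∧ ∃ v : E4, HasDerivAt c v t ∧ B n (c t) v v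
      < 0 ∧ 0 < v 0) → z ∈ O n) → (∀ n, Kerr.orbitCurve a r₀ √(M / r₀ ^ 3) 0 ∈ C n ∧ Kerr.orbitCurve a r₀ √(M / r₀ ^ 3) 0 ∉ O n) → (∀ n, ∀ y ∈ C n, Kerr.orbitCurve a r₀ √(M / r₀ ^ 3) 0 0 ≤ y
      0) → ∀ (s : ℝ), (0 < s) → (10 * s ≤ η₀) → (2 * s ≤ e * S) → ∀ (n : ℕ), (ε n < 1 / 200) → ∃ u ∈ Icc (-s) s, Kerr.orbitCurve a r₀ √(M / r₀ ^ 3) (s / e) + u • E4.basisVector 0 ∈ C n ∧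
      Kerr.orbitCurve a r₀ √(M / r₀ ^ 3) (s / e) + u • E4.basisVector 0 ∉ O n :=
  NoC0.lowest_point

end Summit.FinalStateConjecture.FinalStateConjecture.Theorems.PhaseMixingCaptureCaptureSufficesTame

end
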